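/-
Copyright (c) 2026. All rights reserved.
Released under Apache 2.0 license as described in the file LICENSE.
-/
import Literature.NumberTheory.Automorphic.QuadraticOrdersRhoLegendre
import HarnessLib

/-!
# The root counts `ρ_p(0,1) = #{x : x² + 1 ≡ 0}` and `ρ_p(1,1) = #{x : x² − x + 1 ≡ 0}` modulo a prime, by residue class:
# `(−4∕p)` by `p mod 4` and `(−3∕p)` by `p mod 3`

[tag: quadratic_orders] [tag: legendre_symbol]

Topic `NumberTheory/Automorphic`; THEOREMS ONLY (no definition, no named fact, no instance; net Literature debt `0`).
Lane `lit-hodgefound`, seat p12, gen 47. These are the two Legendre symbols of Eichler's class number formula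
(Voight Thm. 30.1.5: `ε₂ = ∏(1 − (−4∕p))`, `ε₃ = ∏(1 − (−3∕p))`; the tree's root counts `Brandt.rho`, with
`ρ_p(t,n) = 1 + ((t² − 4n)∕p)` for odd `p`, `QuadraticOrdersRhoLegendre`), made explicit by residue classes:

* `Brandt.rho_zero_one_eq_zero_iff` (`ρ_p(0,1) = 0 ⟺ p ≡ 3 (mod 4)`, any prime `p`; Mathlib's first supplement
  `ZMod.exists_sq_eq_neg_one_iff`), `Brandt.rho_zero_one_eq_two_iff` (`p ≠ 2`: `ρ_p(0,1) = 2 ⟺ p ≡ 1 (mod 4)`);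
* `Brandt.rho_one_one_eq_zero_iff` (`ρ_p(1,1) = 0 ⟺ p ≡ 2 (mod 3)`, any prime `p` — Ireland–Rosen Ch. 5 Exercise 14: for
  `p ≡ 1 (3)` an element `g` of order `3` of `(ℤ/p)^×` gives the root `−g` of `x² − x + 1`; for `p ≡ 2 (3)` a root would satisfy
  `x³ = −1` and `x^{p−1} = 1` with `p − 1 ≡ 1 (3)`, forcing `x = ±1`), `Brandt.rho_one_one_eq_two_iff` (`p ≠ 3`: `ρ_p(1,1) = 2 ⟺
  p ≡ 1 (mod 3)`);
* the Legendre symbols: `legendreSym_neg_four_eq` (`p` odd: `(−4∕p) = 1` if `p ≡ 1 (4)`, `−1` if `p ≡ 3 (4)`),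
  **`legendreSym_neg_three_eq`** (`p ∉ {2, 3}`: `(−3∕p) = 1` if `p ≡ 1 (3)`, `−1` if `p ≡ 2 (3)` — «−3 is a quadratic residue mod p
  iff p is congruent to 1 or −5 mod 12», Ireland–Rosen Ch. 5 §2).

## Sources

* K. Ireland, M. Rosen, *A Classical Introduction to Modern Number Theory*, GTM 84 (1982), Ch. 5 §1 Prop. 5.1.2 Cor. 3 (`(−1∕p)`),
  Ch. 5 §2 («Summarizing, −3 is a quadratic residue mod p iff p is congruent to 1 or −5 mod 12»), Ch. 5 Exercise 14.
  [cite: IrelandRosen1982, Ch. 5 §2 and Exercise 14]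
* D. A. Cox, *Primes of the form x² + ny²*, 2nd ed. (2013), Lemma 1.7, §7.D Prop. 7.20. [cite: Cox2013, Lemma 1.7]
-/

open Finset

namespace Literature.NumberTheory.Automorphic

namespace Brandt

variable {p : ℕ} [hp : Fact p.Prime]

/-! ## `ρ_p(0, 1)` and `p mod 4` -/

/-- **`ρ_p(0, 1) = 0 ⟺ p ≡ 3 (mod 4)`** for `p` prime: `x² + 1 ≡ 0 (mod p)` is solvable iff `−1` is a square mod `p`
(the first supplement, Mathlib's `ZMod.exists_sq_eq_neg_one_iff`). [cite: IrelandRosen1982, Ch. 5 §1 Prop. 5.1.2 Cor. 3] -/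
theorem rho_zero_one_eq_zero_iff : rho p 0 1 = 0 ↔ p % 4 = 3 := by
  haveI : NeZero p := ⟨hp.out.ne_zero⟩
  have key : rho p 0 1 = 0 ↔ ¬ IsSquare (-1 : ZMod p) := by
    rw [rho_eq_card_zmod, Finset.card_eq_zero, Finset.filter_eq_empty_iff]
    push_cast
    simp only [Finset.mem_univ, zero_mul, sub_zero, true_implies]
    constructor
    · rintro h ⟨r, hr⟩
      exact h (x := r) (by rw [sq, ← hr, neg_add_cancel])
    · intro h x hx
      exact h ⟨x, by rw [← sq]; exact (eq_neg_of_add_eq_zero_left hx).symm⟩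
  rw [key, ZMod.exists_sq_eq_neg_one_iff, not_ne_iff]

/-- `(−4 : ℤ∕p) ≠ 0` for an odd prime `p`. [folklore] -/
private theorem neg_four_ne_zero (hp2 : p ≠ 2) : ((-4 : ℤ) : ZMod p) ≠ 0 := by
  haveI : NeZero p := ⟨hp.out.ne_zero⟩
  intro h0
  have h4 : (p : ℤ) ∣ -4 := (ZMod.intCast_zmod_eq_zero_iff_dvd (-4) p).mp h0
  have h4' : p ∣ 4 := by exact_mod_cast (dvd_neg.mp h4)
  have h2 : p ∣ 2 := hp.out.dvd_of_dvd_pow (show p ∣ 2 ^ 2 by norm_num; exact h4')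
  exact hp2 ((Nat.prime_dvd_prime_iff_eq hp.out Nat.prime_two).mp h2)

/-- `(−3 : ℤ∕p) ≠ 0` for a prime `p ≠ 3`. [folklore] -/
private theorem neg_three_ne_zero (hp3 : p ≠ 3) : ((-3 : ℤ) : ZMod p) ≠ 0 := by
  haveI : NeZero p := ⟨hp.out.ne_zero⟩
  intro h0
  have h3 : (p : ℤ) ∣ -3 := (ZMod.intCast_zmod_eq_zero_iff_dvd (-3) p).mp h0
  have h3' : p ∣ 3 := by exact_mod_cast (dvd_neg.mp h3)
  exact hp3 ((Nat.prime_dvd_prime_iff_eq hp.out Nat.prime_three).mp h3')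

/-- **`ρ_p(0, 1) = 2 ⟺ p ≡ 1 (mod 4)`** for an odd prime `p` (`ρ = 1 + (−4∕p) ∈ {0, 2}`). [cite: IrelandRosen1982, Ch. 5 §1 Prop. 5.1.2 Cor. 3] -/
theorem rho_zero_one_eq_two_iff (hp2 : p ≠ 2) : rho p 0 1 = 2 ↔ p % 4 = 1 := by
  have h := rho_eq_one_add_legendreSym (q := p) hp2 0 1
  norm_num at h
  have hodd : p % 2 = 1 := hp.out.mod_two_eq_one_iff_ne_two.mpr hp2
  have h0 : rho p 0 1 = 0 ↔ p % 4 = 3 := rho_zero_one_eq_zero_iff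
  rcases legendreSym.eq_one_or_neg_one p (neg_four_ne_zero hp2) with hl | hl <;> rw [hl] at h
  · have h2 : rho p 0 1 = 2 := by omega
    have : p % 4 ≠ 3 := fun h4 => by have := h0.mpr h4; omega
    constructor <;> intro <;> omega
  · have h2 : rho p 0 1 = 0 := by omega
    have := h0.mp h2
    constructor <;> intro <;> omega

/-- **`(−4∕p)` BY RESIDUE CLASS** (`p` odd): `(−4∕p) = (−1∕p) = 1` if `p ≡ 1 (mod 4)` and `−1` if `p ≡ 3 (mod 4)`.
[cite: IrelandRosen1982, Ch. 5 §1 Prop. 5.1.2 Cor. 3] -/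
theorem legendreSym_neg_four_eq (hp2 : p ≠ 2) : legendreSym p (-4) = if p % 4 = 1 then 1 else -1 := by
  have h := rho_eq_one_add_legendreSym (q := p) hp2 0 1
  norm_num at h
  have hodd : p % 2 = 1 := hp.out.mod_two_eq_one_iff_ne_two.mpr hp2
  have h2 := rho_zero_one_eq_two_iff (p := p) hp2
  split_ifs with h4
  · have := h2.mpr h4; omega
  · have h0 : rho p 0 1 = 0 := rho_zero_one_eq_zero_iff.mpr (by omega)
    omega

/-! ## `ρ_p(1, 1)` and `p mod 3` -/

/-- **`ρ_p(1, 1) = 0 ⟺ p ≡ 2 (mod 3)`** for `p` prime: `x² − x + 1` has a root mod `p` iff `p = 3` or `p ≡ 1 (mod 3)` (then `−g`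
for `g ∈ (ℤ∕p)^×` of order `3`; conversely a root `x` has `x³ = −1`, and `x^{p−1} = 1` with `p − 1 = 3k + 1` forces `x = ±1`).
[cite: IrelandRosen1982, Ch. 5 §2 and Exercise 14] -/
theorem rho_one_one_eq_zero_iff : rho p 1 1 = 0 ↔ p % 3 = 2 := by
  haveI : NeZero p := ⟨hp.out.ne_zero⟩
  have key : rho p 1 1 = 0 ↔ ∀ x : ZMod p, x ^ 2 - x + 1 ≠ 0 := by
    rw [rho_eq_card_zmod, Finset.card_eq_zero, Finset.filter_eq_empty_iff]
    push_cast
    simp only [Finset.mem_univ, one_mul, true_implies, ne_eq]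
  rw [key]
  constructor
  · intro h
    by_contra h3
    rcases (by omega : p % 3 = 0 ∨ p % 3 = 1) with h0 | h1
    · have hp3 : p = 3 :=
        ((Nat.prime_dvd_prime_iff_eq Nat.prime_three hp.out).mp (Nat.dvd_of_mod_eq_zero h0)).symm
      refine h (-1) ?_
      have h3' : ((3 : ℕ) : ZMod p) = 0 := by rw [← hp3, ZMod.natCast_self]
      calc (-1 : ZMod p) ^ 2 - -1 + 1 = ((3 : ℕ) : ZMod p) := by push_cast; ring
        _ = 0 := h3'
    · have hcard : 3 ∣ Fintype.card (ZMod p)ˣ := by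
        rw [ZMod.card_units p]
        omega
      obtain ⟨g, hg⟩ := exists_prime_orderOf_dvd_card 3 hcard
      have hg3 : (g : ZMod p) ^ 3 = 1 := by
        have h3 := pow_orderOf_eq_one g
        rw [hg] at h3
        have h3' := congrArg (fun u : (ZMod p)ˣ => (u : ZMod p)) h3
        simpa only [Units.val_pow_eq_pow_val, Units.val_one] using h3'
      have hg1 : (g : ZMod p) ≠ 1 := by
        intro h1
        have hg' : g = 1 := Units.val_eq_one.mp h1
        rw [hg', orderOf_one] at hg
        norm_num at hg
      have hq : (g : ZMod p) ^ 2 + g + 1 = 0 := by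
        have hfac : ((g : ZMod p) - 1) * ((g : ZMod p) ^ 2 + g + 1) = (g : ZMod p) ^ 3 - 1 := by ring
        rw [hg3, sub_self] at hfac
        rcases mul_eq_zero.mp hfac with h' | h'
        · exact absurd (sub_eq_zero.mp h') hg1
        · exact h'
      refine h (-(g : ZMod p)) ?_
      rw [show (-(g : ZMod p)) ^ 2 - -(g : ZMod p) + 1 = (g : ZMod p) ^ 2 + g + 1 by ring, hq]
  · intro h3 x hx
    have hx3 : x ^ 3 = -1 := by
      have e : (x + 1) * (x ^ 2 - x + 1) = x ^ 3 + 1 := by ring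
      rw [hx, mul_zero] at e
      exact eq_neg_of_add_eq_zero_left e.symm
    have hx0 : x ≠ 0 := by
      rintro rfl
      norm_num at hx
    have hF := ZMod.pow_card_sub_one_eq_one hx0
    obtain ⟨k, hk⟩ : ∃ k, p - 1 = 3 * k + 1 := ⟨(p - 2) / 3, by have := hp.out.two_le; omega⟩
    rw [hk, pow_succ, pow_mul, hx3] at hF
    rcases neg_one_pow_eq_or (ZMod p) k with h1 | h1 <;> rw [h1] at hF
    · rw [one_mul] at hF
      rw [hF] at hx
      norm_num at hx
    · rw [neg_one_mul, neg_eq_iff_eq_neg] at hF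
      rw [hF] at hx
      norm_num at hx
      -- `hx : (3 : ZMod p) = 0`
      have h3dvd : p ∣ 3 := (ZMod.natCast_eq_zero_iff 3 p).mp (by exact_mod_cast hx)
      have := (Nat.prime_dvd_prime_iff_eq hp.out Nat.prime_three).mp h3dvd
      omega

/-- **`ρ_p(1, 1) = 2 ⟺ p ≡ 1 (mod 3)`** for a prime `p ≠ 3` (`ρ = 1 + (−3∕p) ∈ {0, 2}` for `p ∉ {2, 3}`; `ρ₂(1,1) = 0`).
[cite: IrelandRosen1982, Ch. 5 §2 and Exercise 14] -/
theorem rho_one_one_eq_two_iff (hp3 : p ≠ 3) : rho p 1 1 = 2 ↔ p % 3 = 1 := by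
  by_cases hp2 : p = 2
  · subst hp2
    decide
  have h := rho_eq_one_add_legendreSym (q := p) hp2 1 1
  norm_num at h
  have h0 : rho p 1 1 = 0 ↔ p % 3 = 2 := rho_one_one_eq_zero_iff
  have hmod : p % 3 ≠ 0 := fun h3 =>
    hp3 ((Nat.prime_dvd_prime_iff_eq Nat.prime_three hp.out).mp (Nat.dvd_of_mod_eq_zero h3)).symm
  rcases legendreSym.eq_one_or_neg_one p (neg_three_ne_zero hp3) with hl | hl <;> rw [hl] at h
  · have h2 : rho p 1 1 = 2 := by omega
    have : p % 3 ≠ 2 := fun h3 => by have := h0.mpr h3; omega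
    constructor <;> intro <;> omega
  · have h2 : rho p 1 1 = 0 := by omega
    have := h0.mp h2
    constructor <;> intro <;> omega

/-- **`(−3∕p)` BY RESIDUE CLASS** (`p ∉ {2, 3}`): `(−3∕p) = 1` if `p ≡ 1 (mod 3)` and `−1` if `p ≡ 2 (mod 3)` — «−3 is a quadratic
residue mod `p` iff `p` is congruent to `1` or `−5 mod 12`». [cite: IrelandRosen1982, Ch. 5 §2 and Exercise 14] -/
theorem legendreSym_neg_three_eq (hp2 : p ≠ 2) (hp3 : p ≠ 3) : legendreSym p (-3) = if p % 3 = 1 then 1 else -1 := by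
  have h := rho_eq_one_add_legendreSym (q := p) hp2 1 1
  norm_num at h
  have h2 := rho_one_one_eq_two_iff (p := p) hp3
  have hmod : p % 3 ≠ 0 := fun h3 =>
    hp3 ((Nat.prime_dvd_prime_iff_eq Nat.prime_three hp.out).mp (Nat.dvd_of_mod_eq_zero h3)).symm
  split_ifs with h1
  · have := h2.mpr h1; omega
  · have h0 : rho p 1 1 = 0 := rho_one_one_eq_zero_iff.mpr (by omega)
    omega

end Brandt

end Literature.NumberTheory.Automorphic
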